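import Mathlib
import Summits.Ventures.PercRepro2.Independence
import Summits.Ventures.PercRepro2.HCov
import Summits.Ventures.PercRepro2.CutVertexPaths
import Summits.Ventures.PercRepro2.CutOneFarConn

/-!
# No mark behind a cut vertex: the mark-free side is invisible to the covariance form
(blind cell PercRepro2, typer-1 g48)

With `v` a cut vertex between `L` and `Rt` and ALL five marks in `Rt ∪ {v}`, the covariance form
of `G` is that of the right side alone (edge type `{e // side e = false}`, weights and ends
restricted): **`Gc_eq_right`**, hence **`HCov_of_right`**.  Proof: the restriction map `ρ` to the
right edges transports connectivity between right vertices (`conn_iff_restrict_right` and the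
equality of the right-restricted open graphs, `openGraph_restrict_right_eq`), and its law is the
restricted product law (`prob_cylinder`); then `Gc_transport_marks'`.

Every class theorem of the cell therefore extends to instances carrying mark-free pendant parts
(trees, blocks, …) at any vertex.
-/

namespace Summit.Ventures.PercRepro2

open CovForm CutVertexM9

namespace CutPrune

section Prune

variable {V : Type*} {E : Type*} [Fintype E] [DecidableEq E] {R : Type*} [Field R]

/-- The right edges. -/
abbrev RightEdge (side : E → Bool) : Type _ := {e : E // side e = false}

/-- The right side of the graph. -/
def rends (ends : E → Sym2 V) (side : E → Bool) : RightEdge side → Sym2 V := fun e => ends e.1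

/-- The right weights. -/
def rweights (side : E → Bool) (p : E → R) : RightEdge side → R := fun e => p e.1

/-- The restriction of a configuration to the right edges. -/
def ρ (side : E → Bool) (ω : Config E) : Config (RightEdge side) := fun e => ω e.1

omit [Fintype E] [DecidableEq E] in
/-- The right weights are admissible. -/
lemma isProbVec_rweights [LinearOrder R] [IsStrictOrderedRing R] {side : E → Bool} {p : E → R}
    (hp : IsProbVec p) : IsProbVec (rweights side p) where
  nonneg e := hp.nonneg e.1
  le_one e := hp.le_one e.1

variable {ends : E → Sym2 V} {side : E → Bool} {L : Set V} {v : V} {Rt : Set V}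

omit [Fintype E] [DecidableEq E] in
/-- The open graph of the right side under `ρ ω` is the right-restricted open graph of `G`. -/
lemma openGraph_restrict_right_eq (ω : Config E) :
    openGraph (rends ends side) (ρ side ω) = openGraph ends (CutVertexM9.restrict side false ω) := by
  ext x y
  simp only [openGraph_adj, OpenAdj, CutVertexM9.restrict, rends, ρ]
  constructor
  · rintro ⟨hxy, e, he, hends⟩
    exact ⟨hxy, e.1, by simp [e.2, he], hends⟩
  · rintro ⟨hxy, e, he, hends⟩
    by_cases hs : side e = false
    · refine ⟨hxy, ⟨e, hs⟩, ?_, hends⟩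
      simpa [hs] using he
    · simp [hs] at he

omit [Fintype E] [DecidableEq E] in
/-- Connectivity between right vertices (and `v`) is the same in `G` and on the right side. -/
theorem conn_right_iff (h : CutVertex ends side L v Rt) (ω : Config E) {x z : V}
    (hx : x ∈ Rt ∨ x = v) (hz : z ∈ Rt ∨ z = v) :
    Conn (rends ends side) (ρ side ω) x z ↔ Conn ends ω x z := by
  rw [conn_iff_restrict_right h hx hz, Conn, Conn, openGraph_restrict_right_eq]

omit [DecidableEq E] in
/-- The fibre of `ρ` is a cylinder over the right edges. -/
lemma fibre_eq (σ' : Config (RightEdge side)) :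
    {ω : Config E | ρ side ω = σ'} =
      cylinder (Finset.univ.filter fun e => side e = false)
        (fun e => if h : side e = false then σ' ⟨e, h⟩ else false) := by
  ext ω
  simp only [Set.mem_setOf_eq, mem_cylinder, Finset.mem_filter, Finset.mem_univ, true_and]
  constructor
  · intro hω e he
    rw [dif_pos he, ← hω]
    rfl
  · intro hω
    funext e
    have := hω e.1 e.2
    rw [dif_pos e.2] at this
    exact this

/-- The law of `ρ` at a point is the right weight. -/
theorem prob_fibre_eq (p : E → R) (σ' : Config (RightEdge side)) :
    prob p {ω | ρ side ω = σ'} = weight (rweights side p) σ' := by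
  classical
  rw [fibre_eq, prob_cylinder, weight, Finset.prod_subtype (p := fun e => side e = false)
    (Finset.univ.filter fun e => side e = false) (fun e => by simp)]
  refine Finset.prod_congr rfl fun e _ => ?_
  simp only [dif_pos e.2, rweights]

/-- **Pushforward**: the probability of a right event under `ρ` is its probability at the right
weights. -/
theorem prob_ρ_preimage (p : E → R) (A : Set (Config (RightEdge side))) :
    prob p (ρ side ⁻¹' A) = prob (rweights side p) A := by
  classical
  calc prob p (ρ side ⁻¹' A)
      = ∑ ω, (ρ side ⁻¹' A).indicator (weight p) ω := rfl
    _ = ∑ σ', ∑ ω ∈ Finset.univ.filter (fun ω => ρ side ω = σ'),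
          (ρ side ⁻¹' A).indicator (weight p) ω :=
        (Finset.sum_fiberwise Finset.univ (ρ side) _).symm
    _ = ∑ σ', A.indicator (fun σ' => prob p {ω | ρ side ω = σ'}) σ' := by
        refine Finset.sum_congr rfl fun σ' _ => ?_
        by_cases hA : σ' ∈ A
        · rw [Set.indicator_of_mem hA]
          unfold prob
          rw [Finset.sum_filter]
          refine Finset.sum_congr rfl fun ω _ => ?_
          by_cases hω : ρ side ω = σ'
          · rw [if_pos hω, Set.indicator_of_mem (show ω ∈ {ω | ρ side ω = σ'} from hω),
              Set.indicator_of_mem (show ω ∈ ρ side ⁻¹' A from by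
                rw [Set.mem_preimage, hω]; exact hA)]
          · rw [if_neg hω, Set.indicator_of_notMem (show ω ∉ {ω | ρ side ω = σ'} from hω)]
        · rw [Set.indicator_of_notMem hA]
          refine Finset.sum_eq_zero fun ω hω => ?_
          rw [Finset.mem_filter] at hω
          rw [Set.indicator_of_notMem]
          rw [Set.mem_preimage, hω.2]
          exact hA
    _ = ∑ σ', A.indicator (weight (rweights side p)) σ' := by
        refine Finset.sum_congr rfl fun σ' _ => ?_
        by_cases hA : σ' ∈ A
        · rw [Set.indicator_of_mem hA, Set.indicator_of_mem hA, prob_fibre_eq]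
        · rw [Set.indicator_of_notMem hA, Set.indicator_of_notMem hA]
    _ = prob (rweights side p) A := rfl

/-- **The mark-free side is invisible**: with every mark in `Rt ∪ {v}`, `Gc` of `G` is `Gc` of the
right side. -/
theorem Gc_eq_right (h : CutVertex ends side L v Rt) (p : E → R) (o a₁ a₂ a₃ b : V)
    (hM : ∀ m ∈ ({o, a₁, a₂, a₃, b} : Set V), m ∈ Rt ∨ m = v) :
    Gc p ends o a₁ a₂ a₃ b = Gc (rweights side p) (rends ends side) o a₁ a₂ a₃ b :=
  (CutOneFar.Gc_transport_marks' (fun A => (prob_ρ_preimage p A).symm) o a₁ a₂ a₃ b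
    (fun ω x hx z hz => conn_right_iff h ω (hM x hx) (hM z hz))).symm

/-- **(HCOV) on `G` from (HCOV) on the right side.** -/
theorem HCov_of_right [LinearOrder R] (h : CutVertex ends side L v Rt) (p : E → R)
    (o a₁ a₂ a₃ b : V) (hM : ∀ m ∈ ({o, a₁, a₂, a₃, b} : Set V), m ∈ Rt ∨ m = v)
    (hright : HCov (rweights side p) (rends ends side) o a₁ a₂ a₃ b) : HCov p ends o a₁ a₂ a₃ b := by
  unfold HCov at hright ⊢
  rw [Gc_eq_right h p o a₁ a₂ a₃ b hM]
  exact hright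

end Prune

end CutPrune

end Summit.Ventures.PercRepro2
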